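import Summits.QuantumFields.YangMills.Theses.SqueezedSkewness
import Summits.QuantumFields.YangMills.Theorems.OnsetSkewLawRPOnsetFloorCoarseCollar
import Summits.QuantumFields.YangMills.Theorems.BalabanLadderNTWeakPackageTwoPoint
import Summits.QuantumFields.YangMills.Theorems.BalabanLadderNTWeakPackage
import Summits.QuantumFields.YangMills.Theorems.LangevinControlUVOSLegsAtWeakCouplingCFblOfFbl6
import HarnessLib

/-!
# Glue: the shared two-point onset residual `OnsetFloorQ2` from the femto two-point unit (item 23679)

ym-idea-11 g14 (planner; offered to provers verbatim).  `RPOnsetFloorCoarseCollar.OnsetFloorQ2` — the registered residual stub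
`stub_onsetFloorQ2` of LINES «FloorInheritance» v5 (23138) / «MarkovFloorInheritance» v3 (22956), = the two-point conjunct of
`OnsetCalibration.OnsetFloors` — follows from `SqueezedSkewness.FemtoTwoPointUnit` (stmt-QuantumFields-23679) by the LANDED weak two-point
floor `Cruxes.NT.WeakPackage.lowerBounds_twoPoint_weak` (+ `fbl_of_fbl6`, `floor_of_fc2`) with resolution `s := a β ≤ 1` eventually.
So the residual of g13's lines is a COROLLARY of 23679 as well (consolidation edge 23679 ⟹ OnsetFloorQ2).  HONEST LABEL: an implication
between open statements; nothing is closed; YM mass gap NOT proved. [folklore]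


LANDING NOTE: authored by planner ym-idea-11 g14 (pub `ym-idea-11/g14/`, verified rc 0 / 0 sorry by idea-crit-9 ACK #80e); landed for the
record by width seat `ym-line-sfw-p2-w4` g21 (cell ym-idea-1, free hands), verbatim.  [folklore]
-/

set_option autoImplicit false

noncomputable section

open MeasureTheory Filter Topology
open Literature.MathematicalPhysics.QuantumFieldTheory Literature.MathematicalPhysics.QuantumLattice
open Summit.QuantumFields.YangMills.Cruxes.OSLegsFromFemtoAndGap.DlrCollarTransfer

namespace Summit.QuantumFields.YangMills.Theorems.RPOnsetFloorFemtoGlue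

/-- **`FemtoTwoPointUnit ⇒ OnsetFloorQ2`**: the femto two-point unit floors `Q2(θv, v)` for ONE positive-time bump `v` at resolution
`s = a β → 0` (`lowerBounds_twoPoint_weak`), and `a β ≤ 1` for `β` large. [folklore] -/
theorem onsetFloorQ2_of_femtoTwoPointUnit (hU : Summit.QuantumFields.YangMills.Theses.SqueezedSkewness.FemtoTwoPointUnit) :
    Summit.QuantumFields.YangMills.Theorems.RPOnsetFloorCoarseCollar.OnsetFloorQ2 := by
  intro G _ _ _ _ hG _hSU
  letI : MeasurableSpace G := borel G
  haveI : BorelSpace G := ⟨rfl⟩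
  obtain ⟨r, a, ha, ha0, hFBL6, hFC2⟩ := hU G hG
  obtain ⟨v, ε, β₅, Λ₅, hv, hε, H⟩ :=
    Summit.QuantumFields.YangMills.Cruxes.NT.WeakPackage.lowerBounds_twoPoint_weak G r a ha ha0 (fbl_of_fbl6 r a hFBL6)
      (Summit.QuantumFields.YangMills.Cruxes.NT.WeakPackage.floor_of_fc2 G r a hFC2)
  obtain ⟨β₆, hβ₆⟩ := (ha0.eventually (eventually_le_nhds one_pos)).exists_forall_of_atTop
  refine ⟨r, v, ε, Λ₅, max β₅ β₆, hv, hε, fun β hβ => ⟨a β, ha β, hβ₆ β (le_of_max_le_right hβ), fun L hL => ?_⟩⟩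
  exact H β (le_of_max_le_left hβ) L hL

end Summit.QuantumFields.YangMills.Theorems.RPOnsetFloorFemtoGlue

end
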